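import Summits.MatrixMultiplication.OmegaCensus.SmallFormats.MatMul22nRankGF7Slack5Search
import HarnessLib

/-!
# ω-census family (a): replay of the slack-5 search certificate, CHECK A part 4 of 12 (elements `84 ≤ h < 112`)

Cell `pub-omega` (unit `pub-omega-tensor-g16`), topic `Summits/MatrixMultiplication/OmegaCensus` (sub-folder `SmallFormats`).
Framing (verbatim): lottery ticket; floor = certified bounds/negative ranges. HONEST FRAMING: machine-generated kernel replay
(`pub-omega-tensor-g16/code/gen5_runs.py`): `levelsOK5n h = true` for the elements `84 ≤ h < 112` of `PGL₂(7)`: for every slot `(c, h)`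
(`c < 656`) and bucket level, if the key of its column is visited then the bucket holds an entry with that column (SIMD key planes,
`MatMul22nRankGF7Plane`). Meaning: `slotOK5_of_levelsOK5` (`MatMul22nRankGF7Slack5SearchSound`). Nothing here is progress on `ω`.
-/

namespace Summit.MatrixMultiplication.OmegaCensus.SmallFormats

set_option Elab.async false

set_option maxRecDepth 100000 in
set_option maxHeartbeats 400000000 in
/-- Elements `84 ≤ h < 88`. -/
theorem levelsOK5_ok_84_88 : ∀ h : Fin 336, 84 ≤ h.val → h.val < 88 → levelsOK5n h.val = true := by decide +kernel

set_option maxRecDepth 100000 in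
set_option maxHeartbeats 400000000 in
/-- Elements `88 ≤ h < 92`. -/
theorem levelsOK5_ok_88_92 : ∀ h : Fin 336, 88 ≤ h.val → h.val < 92 → levelsOK5n h.val = true := by decide +kernel

set_option maxRecDepth 100000 in
set_option maxHeartbeats 400000000 in
/-- Elements `92 ≤ h < 96`. -/
theorem levelsOK5_ok_92_96 : ∀ h : Fin 336, 92 ≤ h.val → h.val < 96 → levelsOK5n h.val = true := by decide +kernel

set_option maxRecDepth 100000 in
set_option maxHeartbeats 400000000 in
/-- Elements `96 ≤ h < 100`. -/
theorem levelsOK5_ok_96_100 : ∀ h : Fin 336, 96 ≤ h.val → h.val < 100 → levelsOK5n h.val = true := by decide +kernel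

set_option maxRecDepth 100000 in
set_option maxHeartbeats 400000000 in
/-- Elements `100 ≤ h < 104`. -/
theorem levelsOK5_ok_100_104 : ∀ h : Fin 336, 100 ≤ h.val → h.val < 104 → levelsOK5n h.val = true := by decide +kernel

set_option maxRecDepth 100000 in
set_option maxHeartbeats 400000000 in
/-- Elements `104 ≤ h < 108`. -/
theorem levelsOK5_ok_104_108 : ∀ h : Fin 336, 104 ≤ h.val → h.val < 108 → levelsOK5n h.val = true := by decide +kernel

set_option maxRecDepth 100000 in
set_option maxHeartbeats 400000000 in
/-- Elements `108 ≤ h < 112`. -/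
theorem levelsOK5_ok_108_112 : ∀ h : Fin 336, 108 ≤ h.val → h.val < 112 → levelsOK5n h.val = true := by decide +kernel

/-- CHECK A for the elements `84 ≤ h < 112`. -/
theorem levelsOK5_run_4 : ∀ h : Fin 336, 84 ≤ h.val → h.val < 112 → levelsOK5n h.val = true := by
  intro h hlo hhi
  by_cases h88 : h.val < 88
  · exact levelsOK5_ok_84_88 h (by omega) h88
  by_cases h92 : h.val < 92
  · exact levelsOK5_ok_88_92 h (by omega) h92
  by_cases h96 : h.val < 96
  · exact levelsOK5_ok_92_96 h (by omega) h96
  by_cases h100 : h.val < 100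
  · exact levelsOK5_ok_96_100 h (by omega) h100
  by_cases h104 : h.val < 104
  · exact levelsOK5_ok_100_104 h (by omega) h104
  by_cases h108 : h.val < 108
  · exact levelsOK5_ok_104_108 h (by omega) h108
  exact levelsOK5_ok_108_112 h (by omega) hhi

end Summit.MatrixMultiplication.OmegaCensus.SmallFormats
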